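import Summits.KontsevichZagierPeriods.KontsevichZagierPeriods.Theses.OctahedralSymmetry
import Summits.KontsevichZagierPeriods.KontsevichZagierPeriods.Theorems.OctahedralSymmetryLevelFourStuffleInKZStubTransportCubical
import Summits.KontsevichZagierPeriods.KontsevichZagierPeriods.Theorems.OctahedralSymmetryLevelFourStuffleInKZStubTransportSpectator
import Literature.NumberTheory.Transcendental.KZProductIdeal
import Literature.NumberTheory.Transcendental.KZLogCalculusProofs

/-!
# `LevelFourStuffleInKZ` (stmt-KontsevichZagierPeriods-9434, route `OctahedralSymmetry`) — line `Sketch`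
(gaussian cube chart): the composition (crux PROVED)

The crux: for poles `p = i^a` (`a ≠ 0`), `q = i^b`, `pq = i^{a+b}`, the level-4 depth-(1)×(2) stuffle
`I(a)·I(0,b) = I(a,0,a+b) + I(0,b,a+b) − I(0,0,a+b)`, as membership in `KZ.relations` of
`[P] − [A] − [B] + [C]` for the real parts and for the imaginary parts of the four rational
representations (`P` on `(0,1) × Δ₂`, `A`, `B`, `C` on `Δ₃ = {1 > t₀ > t₁ > t₂ > 0}`).

LINE. Pull the four representations back to the open cube `(0,1)³`: `P` along the spectator chart
`s ↦ (s₀, s₁, s₁s₂)` (|J| = `s₁`), `A`, `B`, `C` along the cumulative chart `s ↦ (s₀, s₀s₁, s₀s₁s₂)`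
(|J| = `s₀²s₁`), `B` followed by the coordinate swap `s₀ ↔ s₂`; every pulled-back representation EXISTS
because integrability is transported (`monomialChart_transport`). On the cube the crux is the pointwise
partial fraction `1/((u−p)(v−q)) = u/((u−p)(uv−pq)) + v/((v−q)(uv−pq)) − 1/(uv−pq)` (`u = s₀`,
`v = s₁s₂`), real and imaginary parts separately: two integrand-additivity moves each.

Stubs of the registered skeleton (`Cruxes/LevelFourStuffleInKZ/Lines/Sketch.lean`):
`stub_transportCubical`, `stub_transportSpectator` (rule 2; landed as the two imported sibling files),
`stub_fourTermChain` (glue: 2 transports + swap + rule 1b), `stub_kernelIdentityRe`,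
`stub_kernelIdentityIm` (pointwise algebra, `fin_cases` + `field_simp` + `ring` over all 16 `(a,b)`),
proved here, and the composition `LevelFourStuffleInKZ_of`. No Newton–Leibniz move, no unproved fact;
every intermediate representation is the transport of one of the given `P`, `A`, `B`, `C`.

References: M. Kontsevich, D. Zagier, *Periods* (2001), §1.2 rules (1), (2); M. E. Hoffman, *The algebra
of multiple harmonic series*, J. Algebra 194 (1997), Thm 3.2 (harmonic product); I. Soudères, *Motivic
double shuffle*, IJNT 6 (2010), §1.3 (cubical coordinates).
-/

noncomputable section

open Set MeasureTheory
open Literature.NumberTheory.Transcendental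
open Literature.NumberTheory.Transcendental.KZ
open Summit.KontsevichZagierPeriods.KontsevichZagierPeriods.Theses.OctahedralSymmetry (LevelFourStuffleInKZ)

namespace Summit.KontsevichZagierPeriods.OctahedralSymmetry.LevelFourStuffleInKZ

/-! ## The chain and the kernel identities -/

-- STUBS `stub_transportCubical` (worker) and `stub_transportSpectator` (lead) LANDED as sibling files
-- `Theorems/OctahedralSymmetryLevelFourStuffleInKZStubTransportCubical.lean`,
-- `Theorems/OctahedralSymmetryLevelFourStuffleInKZStubTransportSpectator.lean` (imported).

/-- **Stub `stub_fourTermChain`** (the chain): if the Jacobian-weighted pull-backs of `P`, `A`, `B`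
(after the swap `s₀ ↔ s₂`), `C` cancel POINTWISE on the open cube, then `[P] − [A] − [B] + [C]` is a
KZ relation (two transports, one reindexing, two integrand-additivity moves).
[cite: KontsevichZagier2001, §1.2 rules (1), (2)] -/
theorem stub_fourTermChain (P A B C : IntegralRep 3)
    (hP : P.domain = {t | (0 < t 0 ∧ t 0 < 1) ∧ 1 > t 1 ∧ t 1 > t 2 ∧ t 2 > 0})
    (hA : A.domain = {t | 1 > t 0 ∧ t 0 > t 1 ∧ t 1 > t 2 ∧ t 2 > 0})
    (hB : B.domain = A.domain) (hC : C.domain = A.domain)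
    (hId : ∀ s : Fin 3 → ℝ, (∀ i, s i ∈ Set.Ioo (0:ℝ) 1) →
      P.integrand ![s 0, s 1, s 1 * s 2] * s 1
        - A.integrand ![s 0, s 0 * s 1, s 0 * s 1 * s 2] * (s 0 ^ 2 * s 1)
        - B.integrand ![s 2, s 1 * s 2, s 0 * s 1 * s 2] * (s 1 * s 2 ^ 2)
        + C.integrand ![s 0, s 0 * s 1, s 0 * s 1 * s 2] * (s 0 ^ 2 * s 1) = 0) :
    of P - of A - of B + of C ∈ relations := by
  obtain ⟨Pt, hPtd, hPti, hPte⟩ := stub_transportSpectator P hP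
  obtain ⟨At, hAtd, hAti, hAte⟩ := stub_transportCubical A hA
  obtain ⟨Bt, hBtd, hBti, hBte⟩ := stub_transportCubical B (hB.trans hA)
  obtain ⟨Ct, hCtd, hCti, hCte⟩ := stub_transportCubical C (hC.trans hA)
  -- the coordinate swap `s₀ ↔ s₂` on the `B`-term (one change of variables)
  set σ : Fin 3 ≃ Fin 3 := Equiv.swap 0 2 with hσ
  have hBs : of Bt - of (Bt.reindex σ) ∈ relations := of_sub_of_reindex_mem_relations Bt σ
  have hBsd : (Bt.reindex σ).domain = {s : Fin 3 → ℝ | ∀ i, s i ∈ Set.Ioo (0:ℝ) 1} := by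
    ext w
    simp only [IntegralRep.reindex_domain, hBtd, Set.mem_setOf_eq]
    constructor
    · intro h i; simpa [hσ, Equiv.swap_apply_self] using h (σ i)
    · intro h i; exact h (σ i)
  have hBsi : ∀ w : Fin 3 → ℝ, (∀ i, w i ∈ Set.Ioo (0:ℝ) 1) →
      (Bt.reindex σ).integrand w =
        B.integrand ![w 2, w 1 * w 2, w 0 * w 1 * w 2] * (w 1 * w 2 ^ 2) := by
    intro w hw
    have hw' : (fun i => w (σ i)) ∈ {s : Fin 3 → ℝ | ∀ i, s i ∈ Set.Ioo (0:ℝ) 1} := fun i => hw (σ i)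
    simp only [IntegralRep.reindex_integrand]
    rw [hBti _ hw']
    have h0 : σ 0 = 2 := by simp [hσ]
    have h1 : σ 1 = 1 := by rw [hσ, Equiv.swap_apply_of_ne_of_ne] <;> decide
    have h2 : σ 2 = 0 := by simp [hσ]
    simp only [h0, h1, h2]
    have hv : (![w 2, w 2 * w 1, w 2 * w 1 * w 0] : Fin 3 → ℝ) =
        ![w 2, w 1 * w 2, w 0 * w 1 * w 2] := by
      funext i
      fin_cases i <;> simp <;> ring
    rw [hv]
    ring
  -- integrand additivity on the cube: `Pt = At + (Bt ∘ σ) + (−Ct)`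
  have hadd : of Pt - of At -
      ∑ i : Fin 2, of ((![Bt.reindex σ, Ct.neg] : Fin 2 → IntegralRep 3) i) ∈ relations := by
    refine of_sub_of_sub_sum_mem_relations 2 Pt At ![Bt.reindex σ, Ct.neg] (by rw [hAtd, hPtd])
      ?_ ?_
    · intro i
      fin_cases i
      · simpa [hPtd] using hBsd
      · simp [hCtd, hPtd]
    · intro s hs
      rw [hPtd] at hs
      have hs' : ∀ i, s i ∈ Set.Ioo (0:ℝ) 1 := hs
      simp only [Fin.sum_univ_two, Matrix.cons_val_zero, Matrix.cons_val_one,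
        IntegralRep.integrand_neg, Pi.neg_apply]
      rw [hPti s hs, hAti s hs, hBsi s hs', hCti s hs]
      linear_combination hId s hs'
  have hneg : of Ct + of Ct.neg ∈ relations :=
    of_add_of_mem_relations_of_eqOn_neg (by simp) (fun x _ => by simp)
  -- assembly
  have key : of P - of A - of B + of C =
      -(of Pt - of P) + (of Pt - of At -
        ∑ i : Fin 2, of ((![Bt.reindex σ, Ct.neg] : Fin 2 → IntegralRep 3) i))
        + (of At - of A) - (of Bt - of (Bt.reindex σ)) + (of Bt - of B) + (of Ct + of Ct.neg)
        - (of Ct - of C) := by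
    simp only [Fin.sum_univ_two, Matrix.cons_val_zero, Matrix.cons_val_one]
    abel
  rw [key]
  exact relations.sub_mem (relations.add_mem (relations.add_mem (relations.sub_mem
    (relations.add_mem (relations.add_mem (relations.neg_mem hPte) hadd) hAte) hBs) hBte) hneg) hCte

/-- **Stub `stub_kernelIdentityRe`**: the real part of the pointwise partial fraction on the cube,
with the typed letter tables. [folklore] -/
theorem stub_kernelIdentityRe (re im : Fin 4 → ℝ → ℝ)
    (hre : re = ![fun t => 1 / (t - 1), fun t => t / (1 + t ^ 2), fun t => 1 / (1 + t),
      fun t => t / (1 + t ^ 2)])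
    (him : im = ![fun _ => 0, fun t => 1 / (1 + t ^ 2), fun _ => 0, fun t => -1 / (1 + t ^ 2)])
    (a b : Fin 4) (s : Fin 3 → ℝ) (hs : ∀ i, s i ∈ Set.Ioo (0:ℝ) 1) :
    (re a (s 0) * re b (s 1 * s 2) - im a (s 0) * im b (s 1 * s 2)) / s 1 * s 1
      - (re a (s 0) * re (a + b) (s 0 * s 1 * s 2) - im a (s 0) * im (a + b) (s 0 * s 1 * s 2))
          / (s 0 * s 1) * (s 0 ^ 2 * s 1)
      - (re b (s 1 * s 2) * re (a + b) (s 0 * s 1 * s 2) - im b (s 1 * s 2) * im (a + b) (s 0 * s 1 * s 2))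
          / s 2 * (s 1 * s 2 ^ 2)
      + re (a + b) (s 0 * s 1 * s 2) / (s 0 * (s 0 * s 1)) * (s 0 ^ 2 * s 1) = 0 := by
  subst hre him
  obtain ⟨h0, h0'⟩ := hs 0
  obtain ⟨h1, h1'⟩ := hs 1
  obtain ⟨h2, h2'⟩ := hs 2
  generalize s 0 = u at *
  generalize s 1 = v at *
  generalize s 2 = w at *
  have hu : u ≠ 0 := h0.ne'
  have hv : v ≠ 0 := h1.ne'
  have hw : w ≠ 0 := h2.ne'
  have hu1 : u - 1 ≠ 0 := by linarith
  have hvw1 : v * w - 1 ≠ 0 := by nlinarith [mul_lt_mul'' h1' h2' h1.le h2.le]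
  have huvw1 : u * v * w - 1 ≠ 0 := by
    have : u * v * w < 1 := by
      calc u * v * w < 1 * 1 * 1 := by
            apply mul_lt_mul'' (mul_lt_mul'' h0' h1' h0.le h1.le) h2' (by positivity) h2.le
        _ = 1 := by ring
    linarith
  have hu2 : 1 + u ≠ 0 := by linarith
  have hvw2 : 1 + v * w ≠ 0 := by nlinarith [mul_pos h1 h2]
  have huvw2 : 1 + u * v * w ≠ 0 := by nlinarith [mul_pos (mul_pos h0 h1) h2]
  have hu3 : 1 + u ^ 2 ≠ 0 := by positivity
  have hvw3 : 1 + (v * w) ^ 2 ≠ 0 := by positivity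
  have huvw3 : 1 + (u * v * w) ^ 2 ≠ 0 := by positivity
  fin_cases a <;> fin_cases b <;> simp <;> field_simp <;> ring

/-- **Stub `stub_kernelIdentityIm`**: the imaginary part of the pointwise partial fraction on the cube,
with the typed letter tables. [folklore] -/
theorem stub_kernelIdentityIm (re im : Fin 4 → ℝ → ℝ)
    (hre : re = ![fun t => 1 / (t - 1), fun t => t / (1 + t ^ 2), fun t => 1 / (1 + t),
      fun t => t / (1 + t ^ 2)])
    (him : im = ![fun _ => 0, fun t => 1 / (1 + t ^ 2), fun _ => 0, fun t => -1 / (1 + t ^ 2)])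
    (a b : Fin 4) (s : Fin 3 → ℝ) (hs : ∀ i, s i ∈ Set.Ioo (0:ℝ) 1) :
    (re a (s 0) * im b (s 1 * s 2) + im a (s 0) * re b (s 1 * s 2)) / s 1 * s 1
      - (re a (s 0) * im (a + b) (s 0 * s 1 * s 2) + im a (s 0) * re (a + b) (s 0 * s 1 * s 2))
          / (s 0 * s 1) * (s 0 ^ 2 * s 1)
      - (re b (s 1 * s 2) * im (a + b) (s 0 * s 1 * s 2) + im b (s 1 * s 2) * re (a + b) (s 0 * s 1 * s 2))
          / s 2 * (s 1 * s 2 ^ 2)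
      + im (a + b) (s 0 * s 1 * s 2) / (s 0 * (s 0 * s 1)) * (s 0 ^ 2 * s 1) = 0 := by
  subst hre him
  obtain ⟨h0, h0'⟩ := hs 0
  obtain ⟨h1, h1'⟩ := hs 1
  obtain ⟨h2, h2'⟩ := hs 2
  generalize s 0 = u at *
  generalize s 1 = v at *
  generalize s 2 = w at *
  have hu : u ≠ 0 := h0.ne'
  have hv : v ≠ 0 := h1.ne'
  have hw : w ≠ 0 := h2.ne'
  have hu1 : u - 1 ≠ 0 := by linarith
  have hvw1 : v * w - 1 ≠ 0 := by nlinarith [mul_lt_mul'' h1' h2' h1.le h2.le]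
  have huvw1 : u * v * w - 1 ≠ 0 := by
    have : u * v * w < 1 := by
      calc u * v * w < 1 * 1 * 1 := by
            apply mul_lt_mul'' (mul_lt_mul'' h0' h1' h0.le h1.le) h2' (by positivity) h2.le
        _ = 1 := by ring
    linarith
  have hu2 : 1 + u ≠ 0 := by linarith
  have hvw2 : 1 + v * w ≠ 0 := by nlinarith [mul_pos h1 h2]
  have huvw2 : 1 + u * v * w ≠ 0 := by nlinarith [mul_pos (mul_pos h0 h1) h2]
  have hu3 : 1 + u ^ 2 ≠ 0 := by positivity
  have hvw3 : 1 + (v * w) ^ 2 ≠ 0 := by positivity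
  have huvw3 : 1 + (u * v * w) ^ 2 ≠ 0 := by positivity
  fin_cases a <;> fin_cases b <;> simp <;> field_simp <;> ring

/-! ## Glue: the charts land in the typed domains -/

/-- The cumulative chart maps the open cube into `Δ₃`. [folklore] -/
theorem chartA_mem (s : Fin 3 → ℝ) (hs : ∀ i, s i ∈ Set.Ioo (0:ℝ) 1) :
    (![s 0, s 0 * s 1, s 0 * s 1 * s 2] : Fin 3 → ℝ) ∈
      {t : Fin 3 → ℝ | 1 > t 0 ∧ t 0 > t 1 ∧ t 1 > t 2 ∧ t 2 > 0} := by
  have h0 := hs 0; have h1 := hs 1; have h2 := hs 2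
  simp only [Set.mem_Ioo] at h0 h1 h2
  simp only [Set.mem_setOf_eq, Matrix.cons_val_zero, Matrix.cons_val_one, Matrix.head_cons,
    Matrix.cons_val_two, Matrix.tail_cons]
  refine ⟨h0.2, ?_, ?_, ?_⟩
  · nlinarith [mul_pos h0.1 (sub_pos.mpr h1.2)]
  · nlinarith [mul_pos (mul_pos h0.1 h1.1) (sub_pos.mpr h2.2)]
  · exact mul_pos (mul_pos h0.1 h1.1) h2.1

/-- The swapped cumulative chart maps the open cube into `Δ₃`. [folklore] -/
theorem chartB_mem (s : Fin 3 → ℝ) (hs : ∀ i, s i ∈ Set.Ioo (0:ℝ) 1) :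
    (![s 2, s 1 * s 2, s 0 * s 1 * s 2] : Fin 3 → ℝ) ∈
      {t : Fin 3 → ℝ | 1 > t 0 ∧ t 0 > t 1 ∧ t 1 > t 2 ∧ t 2 > 0} := by
  have h0 := hs 0; have h1 := hs 1; have h2 := hs 2
  simp only [Set.mem_Ioo] at h0 h1 h2
  simp only [Set.mem_setOf_eq, Matrix.cons_val_zero, Matrix.cons_val_one, Matrix.head_cons,
    Matrix.cons_val_two, Matrix.tail_cons]
  refine ⟨h2.2, ?_, ?_, ?_⟩
  · nlinarith [mul_pos h2.1 (sub_pos.mpr h1.2)]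
  · nlinarith [mul_pos (mul_pos h1.1 h2.1) (sub_pos.mpr h0.2)]
  · exact mul_pos (mul_pos h0.1 h1.1) h2.1

/-- The spectator chart maps the open cube into `(0,1) × Δ₂`. [folklore] -/
theorem chartP_mem (s : Fin 3 → ℝ) (hs : ∀ i, s i ∈ Set.Ioo (0:ℝ) 1) :
    (![s 0, s 1, s 1 * s 2] : Fin 3 → ℝ) ∈
      {t : Fin 3 → ℝ | (0 < t 0 ∧ t 0 < 1) ∧ 1 > t 1 ∧ t 1 > t 2 ∧ t 2 > 0} := by
  have h0 := hs 0; have h1 := hs 1; have h2 := hs 2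
  simp only [Set.mem_Ioo] at h0 h1 h2
  simp only [Set.mem_setOf_eq, Matrix.cons_val_zero, Matrix.cons_val_one, Matrix.head_cons,
    Matrix.cons_val_two, Matrix.tail_cons]
  refine ⟨h0, h1.2, ?_, ?_⟩
  · nlinarith [mul_pos h1.1 (sub_pos.mpr h2.2)]
  · exact mul_pos h1.1 h2.1

/-! ## Composition: the stubs imply the crux -/

/-- **The crux from the stubs.** [cite: Hoffman1997, Thm 3.2] -/
theorem LevelFourStuffleInKZ_of : LevelFourStuffleInKZ := by
  intro re im hre him a b _ha P P' A A' B B' C C' hPd hP'd hPi hP'i hAd hA'd hBd hB'd hCd hC'd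
    hAi hA'i hBi hB'i hCi hC'i
  constructor
  · refine stub_fourTermChain P A B C hPd hAd hBd hCd fun s hs => ?_
    rw [hPi (hPd ▸ chartP_mem s hs), hAi (hAd ▸ chartA_mem s hs),
      hBi (hBd ▸ hAd ▸ chartB_mem s hs), hCi (hCd ▸ hAd ▸ chartA_mem s hs)]
    simp only [Matrix.cons_val_zero, Matrix.cons_val_one, Matrix.head_cons, Matrix.cons_val_two,
      Matrix.tail_cons]
    exact stub_kernelIdentityRe re im hre him a b s hs
  · refine stub_fourTermChain P' A' B' C' (hP'd.trans hPd) (hA'd.trans hAd) (hB'd.trans hA'd.symm)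
      (hC'd.trans hA'd.symm) fun s hs => ?_
    rw [hP'i (hP'd ▸ hPd ▸ chartP_mem s hs), hA'i (hA'd ▸ hAd ▸ chartA_mem s hs),
      hB'i (hB'd ▸ hAd ▸ chartB_mem s hs), hC'i (hC'd ▸ hAd ▸ chartA_mem s hs)]
    simp only [Matrix.cons_val_zero, Matrix.cons_val_one, Matrix.head_cons, Matrix.cons_val_two,
      Matrix.tail_cons]
    exact stub_kernelIdentityIm re im hre him a b s hs

end Summit.KontsevichZagierPeriods.OctahedralSymmetry.LevelFourStuffleInKZ
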